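import Summits.Ventures.HodgeRepro2.T5HeckeGelfandTrickGeneral

/-!
# Gelfand's trick transported along a group isomorphism

Tier-5 kernel support (blind cell pub-hodge-repro2, seat p8, gen 11). The record applies the
commutativity of the spherical Hecke algebra to `U(V_v)` at a split place `v`, where
`U(V_v) ≅ GL_n(F_v)` carries the hyperspecial `K_v` onto `GL_n(𝒪_v)`. T5-101 / T5-105 prove the
commutativity for `GL_n(F)` itself; this file moves the hypotheses of Gelfand's trick (T5-84,
`mul_comm_of_antiAut`) along an isomorphism `e : G' ≃* G` with `e(K') = K`, so that the
conclusion holds for `(G', K')` whenever it holds for `(G, K)` through an anti-automorphism.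

* `transportAntiAut e τ : G' ≃* G'ᵐᵒᵖ` — `x ↦ op (e⁻¹ (unop (τ (e x))))`;
* `unop_transportAntiAut_mem_iff` — `τ(K) = K ⇒ τ'(K') = K'`;
* `unop_transportAntiAut_mem_orbit` — `τ(y) ∈ K y K ∀ y ⇒ τ'(x) ∈ K' x K' ∀ x`;
* `cosetMap e he : G' ⧸ K' → G ⧸ K` (injective) and `finite_orbit_of_equiv` — finiteness of the
  double-coset spaces transports along `e`;
* `heckeAlgebra_mul_comm_of_equiv` — **`H(G', K')` is commutative** whenever `(G, K)` satisfies
  the hypotheses of T5-84 and `e(K') = K`.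

Hypotheses as stated in the kernel: groups `G`, `G'`, subgroups `K`, `K'`, an isomorphism
`e : G' ≃* G` with `he : ∀ x, e x ∈ K ↔ x ∈ K'`, the anti-automorphism `τ` of `G` with T5-84's
two conditions, and the finiteness of every `K g K / K` in `G`; `k` the coefficient field.
-/

namespace Summit.Ventures.HodgeRepro2.T5GelfandTransport

open MulOpposite

variable {G G' : Type*} [Group G] [Group G']

/-- The anti-automorphism of `G'` obtained from an anti-automorphism `τ` of `G` through an
isomorphism `e : G' ≃* G`: `x ↦ op (e⁻¹ (unop (τ (e x))))`. -/
def transportAntiAut (e : G' ≃* G) (τ : G ≃* Gᵐᵒᵖ) : G' ≃* G'ᵐᵒᵖ :=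
  (e.trans τ).trans (MulEquiv.op e.symm)

/-- The underlying element of the transported anti-automorphism: `e⁻¹ (unop (τ (e x)))`. -/
@[simp] theorem unop_transportAntiAut (e : G' ≃* G) (τ : G ≃* Gᵐᵒᵖ) (x : G') :
    unop (transportAntiAut e τ x) = e.symm (unop (τ (e x))) := rfl

variable {K : Subgroup G} {K' : Subgroup G'}

/-- `e(K') = K` read backwards: `e.symm y ∈ K' ↔ y ∈ K`. -/
theorem symm_apply_mem_iff (e : G' ≃* G) (he : ∀ x, e x ∈ K ↔ x ∈ K') (y : G) :
    e.symm y ∈ K' ↔ y ∈ K := by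
  rw [← he, e.apply_symm_apply]

/-- T5-84's first hypothesis transports: `τ(K) = K ⇒ τ'(K') = K'`. -/
theorem unop_transportAntiAut_mem_iff (e : G' ≃* G) (he : ∀ x, e x ∈ K ↔ x ∈ K')
    (τ : G ≃* Gᵐᵒᵖ) (hτK : ∀ y, unop (τ y) ∈ K ↔ y ∈ K) (x : G') :
    unop (transportAntiAut e τ x) ∈ K' ↔ x ∈ K' := by
  rw [unop_transportAntiAut, symm_apply_mem_iff e he, hτK, he]

/-- T5-84's second hypothesis transports: `τ(y) ∈ K y K` for all `y ∈ G` gives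
`τ'(x) ∈ K' x K'` for all `x ∈ G'` (orbit form). -/
theorem unop_transportAntiAut_mem_orbit (e : G' ≃* G) (he : ∀ x, e x ∈ K ↔ x ∈ K')
    (τ : G ≃* Gᵐᵒᵖ) (hτ : ∀ y : G, (↑(unop (τ y)) : G ⧸ K) ∈ MulAction.orbit K (↑y : G ⧸ K))
    (x : G') :
    (↑(unop (transportAntiAut e τ x)) : G' ⧸ K') ∈ MulAction.orbit K' (↑x : G' ⧸ K') := by
  obtain ⟨κ, hκ⟩ := MulAction.mem_orbit_iff.mp (hτ (e x))
  change ((↑κ * e x : G) : G ⧸ K) = ↑(unop (τ (e x))) at hκ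
  rw [QuotientGroup.eq] at hκ
  refine MulAction.mem_orbit_iff.mpr ⟨⟨e.symm κ, (symm_apply_mem_iff e he _).mpr κ.2⟩, ?_⟩
  change ((e.symm κ * x : G') : G' ⧸ K') = ↑(unop (transportAntiAut e τ x))
  rw [QuotientGroup.eq, unop_transportAntiAut]
  have : (e.symm ↑κ * x)⁻¹ * e.symm (unop (τ (e x))) =
      e.symm ((↑κ * e x)⁻¹ * unop (τ (e x))) := by
    rw [map_mul, map_inv, map_mul, e.symm_apply_apply]
  rw [this, symm_apply_mem_iff e he]
  exact hκ

/-- The map `G' ⧸ K' → G ⧸ K` induced by `e` (well defined since `e(K') ⊆ K`). -/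
def cosetMap (e : G' ≃* G) (he : ∀ x, e x ∈ K ↔ x ∈ K') : G' ⧸ K' → G ⧸ K :=
  Quotient.map' e fun a b h => by
    rw [QuotientGroup.leftRel_apply] at h ⊢
    rw [← map_inv, ← map_mul, he]
    exact h

/-- `cosetMap` on a coset representative: `xK' ↦ e(x)K`. -/
@[simp] theorem cosetMap_mk (e : G' ≃* G) (he : ∀ x, e x ∈ K ↔ x ∈ K') (x : G') :
    cosetMap e he (x : G' ⧸ K') = ((e x : G) : G ⧸ K) := rfl

/-- `cosetMap` is injective (`e` is injective and reflects the coset relation). -/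
theorem cosetMap_injective (e : G' ≃* G) (he : ∀ x, e x ∈ K ↔ x ∈ K') :
    Function.Injective (cosetMap e he) := by
  intro a b hab
  induction a using QuotientGroup.induction_on with
  | H a =>
  induction b using QuotientGroup.induction_on with
  | H b =>
  rw [cosetMap_mk, cosetMap_mk, QuotientGroup.eq] at hab
  rw [QuotientGroup.eq, ← he, map_mul, map_inv]
  exact hab

/-- `cosetMap` carries the `K'`-orbit of `xK'` into the `K`-orbit of `e(x)K`. -/
theorem cosetMap_mem_orbit (e : G' ≃* G) (he : ∀ x, e x ∈ K ↔ x ∈ K') (x : G')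
    {y : G' ⧸ K'} (hy : y ∈ MulAction.orbit K' (↑x : G' ⧸ K')) :
    cosetMap e he y ∈ MulAction.orbit K (↑(e x) : G ⧸ K) := by
  obtain ⟨κ, rfl⟩ := MulAction.mem_orbit_iff.mp hy
  refine MulAction.mem_orbit_iff.mpr ⟨⟨e κ, (he _).mpr κ.2⟩, ?_⟩
  change ((e κ * e x : G) : G ⧸ K) = cosetMap e he (((κ : G') * x : G') : G' ⧸ K')
  rw [cosetMap_mk, map_mul]

/-- Finiteness of the double-coset spaces transports along `e`: if every `K g K / K` is finite
in `G`, every `K' x K' / K'` is finite in `G'`. -/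
theorem finite_orbit_of_equiv (e : G' ≃* G) (he : ∀ x, e x ∈ K ↔ x ∈ K')
    (hfin : ∀ g : G, Finite (MulAction.orbit K (↑g : G ⧸ K))) (x : G') :
    Finite (MulAction.orbit K' (↑x : G' ⧸ K')) := by
  haveI := hfin (e x)
  refine Finite.of_injective
    (fun y : MulAction.orbit K' (↑x : G' ⧸ K') =>
      (⟨cosetMap e he y, cosetMap_mem_orbit e he x y.2⟩ : MulAction.orbit K (↑(e x) : G ⧸ K)))
    fun y₁ y₂ h => ?_
  exact Subtype.ext (cosetMap_injective e he (congrArg Subtype.val h))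

/-- **Gelfand's trick transported**: if `(G, K, τ)` satisfies the hypotheses of T5-84 and
`e : G' ≃* G` carries `K'` onto `K`, then `H(G', K')` is commutative. -/
theorem heckeAlgebra_mul_comm_of_equiv (k : Type*) [Field k] (e : G' ≃* G)
    (he : ∀ x, e x ∈ K ↔ x ∈ K') (hfin : ∀ g : G, Finite (MulAction.orbit K (↑g : G ⧸ K)))
    (τ : G ≃* Gᵐᵒᵖ) (hτK : ∀ y, unop (τ y) ∈ K ↔ y ∈ K)
    (hτ : ∀ y : G, (↑(unop (τ y)) : G ⧸ K) ∈ MulAction.orbit K (↑y : G ⧸ K))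
    (T S : T5HeckePermutationModule.heckeAlgebra k K') : T * S = S * T :=
  T5HeckeGelfandTrickGeneral.mul_comm_of_antiAut (finite_orbit_of_equiv e he hfin)
    (transportAntiAut e τ) (unop_transportAntiAut_mem_iff e he τ hτK)
    (unop_transportAntiAut_mem_orbit e he τ hτ) T S

end Summit.Ventures.HodgeRepro2.T5GelfandTransport
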